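import Literature.MathematicalPhysics.QuantumFieldTheory.Balaban1983to89.B6Prop23KLevelTorusCensus

/-!
# `Balaban1983to89.B6Ineq288MultiLevelTorus` — [B6] THE FIRST INEQUALITY OF (2.88) FOR THE GENUINE `k`-LEVEL KERNEL
`(∂P∂*)_{μν}(x, x′)`, `P = G′Q′*(Q′G′²Q′*)⁻¹Q′G′` OF (2.17), ON PRINT'S CARRIER, THE TORUS `T_η` (`Ω₁ = T_η`, nested
families (2.1)–(2.2), periodic differences `∂_μ`) — the census edge `B6Ineq288Edge.ineq288_of_printed` («from Lemma 2.1,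
Proposition 2.2 and (2.87)») FIRED WITH EVERY HYPOTHESIS DISCHARGED on the genuine multi-level torus objects, in print's
units AND in lattice units, plus the (2.88)-shape block MAJORANT of `∂P∂*` on the bond carrier of the torus (file 5 of the
torus `(Q′G′²Q′*)⁻¹` programme of seat p21; no existing module is touched; no fact is minted)

FRAMING (verbatim cell line):
statement-level skeleton of published theorems with citation tags; proofs where landed; nothing here is a claim about the Yang–Mills mass gap

Source under audit (cell pub-balaban / lit-balaban): T. Bałaban, *Propagators and renormalization transformations for
lattice gauge theories. II*, Commun. Math. Phys. **96** (1984) 223–250 [`Balaban1984PropagatorsII`, "B6"], p. 225 [PDF 3]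
((2.17)–(2.18)), p. 238 [PDF 16] ((2.88)), p. 224 [PDF 2] ((2.1): «we admit the case when some domains Ω_j are equal to
T_η») — held text `paper:balaban1984-cmp96-propagators-rt-ii` p0002, p0003, p0016 re-read this generation.  Unit
`lit-balaban-p21` (Phase-2 proof seat p21 gen 16), HOME `run/shared/lean/pub/lit-balaban/`, free-target protocol G.5-34(d)
(B6-CLOSURE item 7 (d2) of the fold owner r03; consumers p38 `B6Ineq2134KFamKLevelTorus` slot `hDg`, p22
`B6ScalarChartV1`, r05), referee ref-4.  Neumann-box twin: `B6Ineq288MultiLevelBox` (gen 13), ported section by section.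

## WHAT IS PRINTED (pp. 225, 238, verbatim up to notation)

p. 225: «Let us define the operator P = G′Q′*(Q′G′²Q′*)⁻¹Q′G′, (2.17) and let R be an orthogonal projection in the space
L²(T_η) onto the subspace ΔN(Q′) … R = I − P … Rf = Δλ = Δ′_aλ = f − G′Q′*(Q′G′²Q′*)⁻¹Q′G′f.»  p. 238: «Finally let us
consider the kernel of the operator ∂P∂* appearing in ∂R∂*, R = I − P given by (2.18). We have from Lemma 2.1,
Proposition 2.2 and (2.87), |(∂P∂*)_{μν}(x, x′)| = |(∂_μG′Q′*(Q′G′²Q′*)⁻¹Q′G′∂*_ν)(x, x′)| ≤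
O(1) Σ_{y₁,y₂∈𝔅} L^jη e^{−½δ₀d(y,y₁)}(L^{j₁}η)^{−4}e^{−½δ₁d(y₁,y₂)}(L^{j₂}η)^{−d}·e^{−½δ₀d(y₂,y′)}L^{j′}η ≤
O(1)(L^jη)^{−2}(L^{j′}η)^{−d}e^{−δ₂d(y,y′)}, (2.88) where x ∈ B^j(y), x′ ∈ B^{j′}(y′), y ∈ Λ_j, y′ ∈ Λ_{j′}, and δ₂ is
determined by δ₀, δ₁.»

## WHAT THIS FILE CERTIFIES (kernel-checked)

For every nested family `D : TDomains d ℓ M_h k P R` of domains of the torus (`Ω₁ = T_η`, lattice units, spatial dimension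
`d + 1`, `L ≥ 2`) with the printed weights `a_j = aPrinted 1` and the genuine `G′ = gmlT = Δ′_a⁻¹` on `T_η`:
* §1 (lattice units, for `D` itself) the operator `P = G′Q′*(Q′G′²Q′*)⁻¹Q′G′` of (2.17) as a matrix on the torus (`pM`;
  `Q′* = QsM`, `Q′ = QM`, `(Q′G′²Q′*)⁻¹ = GiM` = the matrix of file 3's `GinvT`; `toMatrix_XopT`, `GiM_mul` — it IS the
  two-sided inverse of the matrix `Q′G′²Q′*`, NO threshold on `M`); **`pM_mul_pM`**, **`pM_transpose`**: `P² = P = Pᵀ`;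
  `rM = I − P`, **`rM_mulVec_eq`** / **`rM_range_QB`** (`Rf = Δ′_aλ` with the printed `λ`, `Q′λ = 0`: `QM_mulVec_lamOf`,
  `QB_lamOf`), **`rM_mulVec_dP_of_ker`** / **`rM_mulVec_dP_of_QB`** (`R(Δ′_aλ) = Δ′_aλ` for `λ ∈ N(Q′)`), **`rM_transpose`**:
  `R` IS the orthogonal projection onto `Δ′_aN(Q′)` of p. 225, i.e. this `P` is the paper's; the kernel
  `(∂_μP∂_νᵀ)(x, x′)` with the PERIODIC forward differences `∂_μ = dT` of file T6 (`dPd`), and the EXACT factorisation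
  **`dPd_eq_comp3`**: `(∂_μP∂*_ν)(x, x′) = Σ_{y₁,y₂} K₁(y, y₁)·C(y₁, y₂)·K₃(y₂, y′)`, `K₁(y, y₁) = (∂_μG′Q′*δ_{y₁})(x)`,
  `K₃(y₂, y′) = (∂_νG′Q′*δ_{y₂})(x′)` (`K1`, `K3`; `G′` symmetric), `C` = the (2.69)-kernel `CinvT` of `(Q′G′²Q′*)⁻¹`
  (`Cker`, `Cker_eq_CinvT`);
* §2 (print's units `η = L^{−k}`, members `i : KTIdx d ℓ` of file T8's family) the census geometry `geoBT i` = file T9's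
  `geoTP i` with the (2.60)-certified `R` (`R·M = R·L·M_h − 1`, as r05's `geomTB`), the census facts `B6.Prop22Printed`
  (file T9 `prop22Printed_kLevelTorusP`) and `B6.Prop23Printed` (file 4 `prop23Printed_kLevelTorusP`) TRANSFERRED to it,
  (2.54), symmetry, (2.60) as `Ineq260` (`ineq260_geoBT`, from `levelSepTB`) and (2.61) (`lemma21_torus`); the kernels in
  print's units (`dPdP = η^{−2−(d+1)}·dPd`, `K1P = η·K₁`, `K3P = η·K₃`) and `dPdP_eq_comp3` with file 4's `CinvTP`;
* §3 THE READING DISCHARGED: `λ_{y₁} = Q′*δ_{y₁} = 1_{B(y₁)}` has `supp ⊂ B(y₁)`, `|λ| ≤ 1`, and `|η·K₁(y, y₁)| ≤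
  (gpTP i).e 1 (λ_{y₁}) y` — the outer kernels ARE dominated by entry (2.67)₂ `∇G′` (periodic difference) of the genuine
  torus functionals (`abs_K1P_le`, `abs_K3P_le`);
* §4 **`ineq288_read_kLevelTorusP`** — the census decl `B6Cor28.Ineq288` INHABITED for the genuine torus kernels
  (`ineq288_of_printed` BY NAME on `geoBT` with §2–§3 and the three largeness conditions `L⁴, L^{d+1}, L ≤ e^{αδRM}`
  exhibited, `α = ½`, `δ = min(δ₀, δ₁)/4`); **`ineq288_kLevelTorusP`** — THE PRINTED (2.88) in print's units:
  `∃ M₃ δ₂ C > 0 ∀ i, M₃ ≤ L·M_h → ∀ μ ν x x′, |(∂P∂*)_{μν}(x, x′)| ≤ C·(L^jη)^{−2}(L^{j′}η)^{−(d+1)}e^{−δ₂d_T(y,y′)}`;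
* §5 **`ineq288_multiLevelTorus`** — (2.88) IN LATTICE UNITS for `D` itself (every `k`, `M_h` with `L·M_h ≥ M₃`,
  `R ≥ 2L`, `P_μ ≥ 4`): `|(∂_μP∂_νᵀ)(x, x′)| ≤ C/((L^j)²·(L^{j′})^{d+1})·e^{−δ₂d_T(y,y′)}` (`(L^{j′})^{d+1} = W(y′)`), the
  entry bound of p22's `B6ScalarChartV1.hasMajorant_Dg_chart` (`ineq288_multiLevelTorus_chartShape`: the same in the
  letters `(S_μ − 1)(1 − R)(S_ν − 1)ᵀ`);
* §6 **`hasMajorant_dPd_multiLevelTorus`** — the (2.88)-SHAPE BLOCK MAJORANT of `∂P∂*` as an operator on bond functions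
  of the torus (`dPdOp`, carrier `T_η × {directions}`, block map `(x, μ) ↦ y(x)`): `HasMajorant blk (∂P∂*)
  (C_P/(L^j)²·e^{−δ₂d_T(y,y″)})`, `C_P = (d+1)·C` (the factor `(L^{j′})^{−(d+1)}` × `#B(y″)` is `≤ 1`) on r05's `geomTB D`
  — the shape of the hypothesis `hDg` of p38's `B6Ineq2134KFamKLevelTorus.h2134_kFam_torus` (rate `δ₂` on `d, L` only).

## HONEST SCOPE

`P` is DEFINED by (2.17) (`pM`) and PROVED to be the paper's: `I − P` is symmetric, idempotent, maps into `Δ′_aN(Q′)` and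
fixes it (§1); print's carrier `T_η` with `Ω₁ = T_η` (levels `1 … k`), `A = 0`, `m² = 0`, `R ≥ 2L`, `L ≥ 2`, `P_μ ≥ 4`
(the charts of (2.67)₁ on `T_η`); the census geometry carries the (2.60)-certified `R − 1/(L·M_h)` for print's integer `R`
(the walk constant `RM − 1` of `levelGapT`); `∂_μ` = the periodic forward difference (`dT`), `∂*_ν = ∂_νᵀ` (equal site
weights); constants existential, depending on `d`, `L`; thresholds folded into `L·M_h ≥ M₃`.  The (2.87) input is file
3's `prop23_multiLevelTorus` ([3] Sect. 5 on the whole of `𝔅`; the expansion (2.86) is not re-derived on `T_η`, see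
there).  Nothing is inferred from the manuscript: every step is kernel-checked.
-/

namespace Literature.MathematicalPhysics.QuantumFieldTheory.Balaban1983to89.B6Ineq288MultiLevelTorus

open Finset Matrix
open Literature.MathematicalPhysics.QuantumFieldTheory.Balaban1983to89.B4Reflection242 (boxDom)
open Literature.MathematicalPhysics.QuantumFieldTheory.Balaban1983to89.B6MultiLevelBoxOperator (N0 Domains aPrinted
  aPrinted_window bigSide)
open Literature.MathematicalPhysics.QuantumFieldTheory.Balaban1983to89.B6MultiLevelTorusOperator
open Literature.MathematicalPhysics.QuantumFieldTheory.Balaban1983to89.B6Geom246MultiLevelBox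
open Literature.MathematicalPhysics.QuantumFieldTheory.Balaban1983to89.B6Geom246MultiLevelTorus
open Literature.MathematicalPhysics.QuantumFieldTheory.Balaban1983to89.B6Ineq268MultiLevelBox
open Literature.MathematicalPhysics.QuantumFieldTheory.Balaban1983to89.B8Ineq192MultiLevelTorus (geomTB geomTB_dist
  geomTB_len geomT_len geomTB_L geomTB_eta geomTB_M geomTB_R geomTB_RM triangleTB symmTB symmT levelSepTB lenT_pos lenT_eq
  W_eq_lenT_pow XkT kerOp_XkT)
open Literature.MathematicalPhysics.QuantumFieldTheory.Balaban1983to89.B6Prop23MultiLevelTorus (isUnit_BmT GinvT CinvT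
  mat_GinvT_div GinvT_mul_X X_mul_GinvT)
open Literature.MathematicalPhysics.QuantumFieldTheory.Balaban1983to89.B6Prop23KLevelTorusCensus
open Literature.MathematicalPhysics.QuantumFieldTheory.Balaban1983to89.B6Prop22DerivMultiLevelTorus (dT dT_mulVec)
open Literature.MathematicalPhysics.QuantumFieldTheory.Balaban1983to89.B6Expansion282 (kerOp)
open Literature.MathematicalPhysics.QuantumFieldTheory.Balaban1983to89.B6Prop23Chain (mat)
open Literature.MathematicalPhysics.QuantumFieldTheory.Balaban1983to89.B6Prop22KLevelTorusCensus (KTIdx kLevelTorus_nonvacuous)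
open Literature.MathematicalPhysics.QuantumFieldTheory.Balaban1983to89.B6Prop22KLevelTorusCensusEta (nKT nKT_pos geoTP gpTP
  geoTP_len kLevelTorusP_nonvacuous prop22Printed_kLevelTorusP)
open Literature.MathematicalPhysics.QuantumFieldTheory.Balaban1983to89.B6Ineq288Edge (ineq288_of_printed)
open Literature.MathematicalPhysics.QuantumFieldTheory.Balaban1983to89.B6RandomWalk (Triangle254 Ineq260 HasMajorant BlockSupp)
open Literature.MathematicalPhysics.QuantumFieldTheory.Balaban1983to89.B6Lemma21Repaired (Ineq261With)
open Literature.MathematicalPhysics.QuantumFieldTheory.Balaban1983to89.B6Cor28 (Ineq288 comp3)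
open Literature.MathematicalPhysics.QuantumFieldTheory.Balaban1983to89.B6Ineq268 (LevelSep mx)
open Literature.MathematicalPhysics.QuantumFieldTheory.Balaban1983to89.B6Ineq261LevelGap (K261 K261_nonneg
  theta_lt_one_of_log)
open Literature.MathematicalPhysics.QuantumFieldTheory.Balaban1983to89.B6 (Geometry GpFamily SiteKernel Prop22Printed
  Prop23Printed pref4)

noncomputable section

variable {d : ℕ}

/-! ## §1 The operator `P` of (2.17) on the torus and the factorisation of `(∂P∂*)(x, x′)` (lattice units) -/

section Kernel

variable {ℓ Mh k R : ℕ} {P : Fin (d + 1) → ℕ} (D : TDomains d ℓ Mh k P R)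

/-- **THE GENUINE `k`-LEVEL `G′ = Δ′_a⁻¹` ON THE TORUS WITH THE PRINTED WEIGHTS** `a_j = aPrinted 1` (`a = 1`, (2.14)).
[cite: Balaban1984PropagatorsII, p.225 («The operator G′ = Δ′_a^{−1}»), (2.13)–(2.14) p.225, Prop. 2.2 p.234 («(a = 1)»)] -/
abbrev GT : Matrix ↥(boxDom (N0 ℓ Mh k P)) ↥(boxDom (N0 ℓ Mh k P)) ℝ := gmlT (N0 ℓ Mh k P) ℓ k D.lev (aPrinted ℓ 1)

/-- `Δ′_a` on the torus with the printed weights (level-`0` weight immaterial). [cite: Balaban1984PropagatorsII, (2.13)–(2.14) p.225] -/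
abbrev dP : Matrix ↥(boxDom (N0 ℓ Mh k P)) ↥(boxDom (N0 ℓ Mh k P)) ℝ := mlOpT (N0 ℓ Mh k P) ℓ k D.lev (aPrinted ℓ 1)

/-- `Q′*` (block-constant extension) as a matrix `T_η × 𝔅`. [cite: Balaban1984PropagatorsII, (2.16)–(2.17) p.225, dictionary] -/
def QsM : Matrix ↥(boxDom (N0 ℓ Mh k P)) ↥(bset D.toDomains) ℝ := fun x y₁ => if blkOf D.toDomains x = y₁ then 1 else 0

/-- `Q′` (block average) as a matrix `𝔅 × T_η`. [cite: Balaban1984PropagatorsII, (2.16)–(2.17) p.225, dictionary] -/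
def QM : Matrix ↥(bset D.toDomains) ↥(boxDom (N0 ℓ Mh k P)) ℝ :=
  fun y₂ x => if blkOf D.toDomains x = y₂ then (W D.toDomains y₂)⁻¹ else 0

/-- `(Q′G′²Q′*)⁻¹` as a matrix on `𝔅` (the inverse operator `GinvT` of file 3). [cite: Balaban1984PropagatorsII, (2.17) p.225, (2.86) p.238] -/
def GiM : Matrix ↥(bset D.toDomains) ↥(bset D.toDomains) ℝ := fun y₁ y₂ => mat (GinvT D (aPrinted ℓ 1)) y₁ y₂

/-- **`P = G′Q′*(Q′G′²Q′*)⁻¹Q′G′`** of (2.17) as a matrix on the torus. [cite: Balaban1984PropagatorsII, (2.17) p.225] -/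
def pM : Matrix ↥(boxDom (N0 ℓ Mh k P)) ↥(boxDom (N0 ℓ Mh k P)) ℝ := GT D * QsM D * GiM D * QM D * GT D

/-- `(∂_μP∂*_ν)(x, x′)` — the matrix `∂_μ·P·∂_νᵀ` (PERIODIC forward differences of the torus, `∂* = ∂ᵀ`).
[cite: Balaban1984PropagatorsII, (2.88) p.238, (2.18) p.225] -/
def dPd (μ ν : Fin (d + 1)) : Matrix ↥(boxDom (N0 ℓ Mh k P)) ↥(boxDom (N0 ℓ Mh k P)) ℝ :=
  dT (N0 ℓ Mh k P) μ * pM D * (dT (N0 ℓ Mh k P) ν)ᵀ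

/-- `λ_{y₁} = Q′*δ_{y₁} = 1_{B(y₁)}` («λ = Q′*δ_{y₁}», the reader's test function). [cite: Balaban1984PropagatorsII, (2.88) p.238 («∂_μG′Q′*»)] -/
def lam (y₁ : ↥(bset D.toDomains)) : ↥(boxDom (N0 ℓ Mh k P)) → ℝ := fun x => if blkOf D.toDomains x = y₁ then 1 else 0

/-- the left outer kernel `K₁(y, y₁) = (∂_μG′Q′*δ_{y₁})(x)` for `x ∈ B(y)` (zero on other rows). [cite: Balaban1984PropagatorsII, (2.88) p.238] -/
def K1 (μ : Fin (d + 1)) (x : ↥(boxDom (N0 ℓ Mh k P))) : ↥(bset D.toDomains) → ↥(bset D.toDomains) → ℝ :=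
  fun y y₁ => if blkOf D.toDomains x = y then ((dT (N0 ℓ Mh k P) μ * GT D) *ᵥ lam D y₁) x else 0

/-- the right outer kernel `K₃(y₂, y′) = (∂_νG′Q′*δ_{y₂})(x′)` for `x′ ∈ B(y′)`. [cite: Balaban1984PropagatorsII, (2.88) p.238] -/
def K3 (ν : Fin (d + 1)) (x' : ↥(boxDom (N0 ℓ Mh k P))) : ↥(bset D.toDomains) → ↥(bset D.toDomains) → ℝ :=
  fun y₂ y' => if blkOf D.toDomains x' = y' then ((dT (N0 ℓ Mh k P) ν * GT D) *ᵥ lam D y₂) x' else 0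

/-- the (2.69)-kernel of `(Q′G′²Q′*)⁻¹` in lattice units: `GinvT(y₁, y₂)/(L^{j₂})^{d+1}`. [cite: Balaban1984PropagatorsII, (2.69) p.235, (2.87) p.238] -/
def Cker : ↥(bset D.toDomains) → ↥(bset D.toDomains) → ℝ := fun y₁ y₂ => mat (GinvT D (aPrinted ℓ 1)) y₁ y₂ / W D.toDomains y₂

/-- `Cker` IS file 3's kernel `CinvT` of `(Q′G′²Q′*)⁻¹`. [cite: Balaban1984PropagatorsII, (2.69) p.235, Prop. 2.3 (2.87) p.238] -/
theorem Cker_eq_CinvT : Cker D = CinvT D (aPrinted ℓ 1) :=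
  funext fun y₁ => funext fun y₂ => mat_GinvT_div D (aPrinted ℓ 1) y₁ y₂

/-- `Q′*` is the matrix of `QsB`. [cite: Balaban1984PropagatorsII, (2.16) p.225, bookkeeping] -/
theorem toMatrix_QsB : LinearMap.toMatrix' (QsB D.toDomains) = QsM D := by
  ext x y₁
  rw [LinearMap.toMatrix'_apply, QsB_apply]
  unfold QsM
  rw [Pi.single_apply]

/-- `Q′` is the matrix of `QB`. [cite: Balaban1984PropagatorsII, (2.14) p.225, bookkeeping] -/
theorem toMatrix_QB : LinearMap.toMatrix' (QB D.toDomains) = QM D := by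
  ext y₂ x
  rw [LinearMap.toMatrix'_apply]
  unfold QB
  rw [B6Ineq2142.avgOp_apply]
  rw [Finset.sum_eq_single x (fun x' _ hx' => by rw [Pi.single_apply, if_neg hx', mul_zero])
    (fun h => absurd (Finset.mem_univ x) h)]
  rw [Pi.single_apply, if_pos rfl, mul_one]
  rfl

/-- `Q′v = QM·v`: the block average as a matrix action. [cite: Balaban1984PropagatorsII, (2.14) p.225, bookkeeping] -/
theorem QB_eq_QM_mulVec (v : ↥(boxDom (N0 ℓ Mh k P)) → ℝ) : QB D.toDomains v = QM D *ᵥ v := by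
  rw [← toMatrix_QB, LinearMap.toMatrix'_mulVec]

/-- `Q′G′²Q′*` is the matrix of the operator `K_W(X)` of file 3 / file 4 (`XopT`). [cite: Balaban1984PropagatorsII, (2.17) p.225, (2.69) p.235, bookkeeping] -/
theorem toMatrix_XopT : LinearMap.toMatrix' (kerOp (W D.toDomains) (XkT D (aPrinted ℓ 1))) = QM D * GT D * GT D * QsM D := by
  rw [kerOp_XkT, LinearMap.toMatrix'_comp, LinearMap.toMatrix'_comp, LinearMap.toMatrix'_comp,
    LinearMap.toMatrix'_toLin', toMatrix_QB, toMatrix_QsB]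
  simp only [Matrix.mul_assoc]

/-- `GiM` is the matrix of `GinvT`. [cite: Balaban1984PropagatorsII, (2.17) p.225, bookkeeping] -/
theorem toMatrix_GinvT : LinearMap.toMatrix' (GinvT D (aPrinted ℓ 1)) = GiM D := by
  ext y₁ y₂
  rw [LinearMap.toMatrix'_apply]
  rfl

/-- `(Q′G′²Q′*)⁻¹·(Q′G′²Q′*) = 1` and `(Q′G′²Q′*)·(Q′G′²Q′*)⁻¹ = 1` as matrices — NO threshold on `M` (file 3's
`isUnit_BmT`: the conjugated kernel is coercive on all of `𝔅`). [cite: Balaban1984PropagatorsII, (2.17) p.225, Prop. 2.3 p.238, p.235 («its inverse is well defined»)] -/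
theorem GiM_mul (hℓ : 1 ≤ ℓ) (hMh : 1 ≤ Mh) (hP : ∀ μ, 1 ≤ P μ) :
    GiM D * (QM D * GT D * GT D * QsM D) = 1 ∧ (QM D * GT D * GT D * QsM D) * GiM D = 1 := by
  have h1 : GiM D * (QM D * GT D * GT D * QsM D) = 1 := by
    rw [← toMatrix_GinvT, ← toMatrix_XopT, ← LinearMap.toMatrix'_mul,
      GinvT_mul_X D (aPrinted ℓ 1) (isUnit_BmT D (aPrinted ℓ 1) hℓ hMh hP (aPrinted_pos hℓ) (aPrinted_le_one hℓ))]
    exact LinearMap.toMatrix'_id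
  exact ⟨h1, mul_eq_one_comm.1 h1⟩

/-- **`P² = P`**: the operator (2.17) is a projection (it is symmetric by `G′ᵀ = G′`, so `R = I − P` is an orthogonal
projection, p. 225). [cite: Balaban1984PropagatorsII, (2.17) p.225 («let R be an orthogonal projection»)] -/
theorem pM_mul_pM (hℓ : 1 ≤ ℓ) (hMh : 1 ≤ Mh) (hP : ∀ μ, 1 ≤ P μ) : pM D * pM D = pM D := by
  have hX := (GiM_mul D hℓ hMh hP).2
  have key : ∀ Z : Matrix ↥(bset D.toDomains) ↥(boxDom (N0 ℓ Mh k P)) ℝ,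
      QM D * (GT D * (GT D * (QsM D * (GiM D * Z)))) = Z := by
    intro Z
    calc QM D * (GT D * (GT D * (QsM D * (GiM D * Z)))) = (QM D * GT D * GT D * QsM D * GiM D) * Z := by
          simp only [Matrix.mul_assoc]
      _ = Z := by rw [hX, Matrix.one_mul]
  unfold pM
  simp only [Matrix.mul_assoc]
  rw [key]

/-- `R = I − P` of (2.17)–(2.18). [cite: Balaban1984PropagatorsII, (2.17)–(2.18) p.225] -/
def rM : Matrix ↥(boxDom (N0 ℓ Mh k P)) ↥(boxDom (N0 ℓ Mh k P)) ℝ := 1 - pM D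

/-- `R² = R`. [cite: Balaban1984PropagatorsII, (2.17) p.225] -/
theorem rM_mul_rM (hℓ : 1 ≤ ℓ) (hMh : 1 ≤ Mh) (hP : ∀ μ, 1 ≤ P μ) : rM D * rM D = rM D := by
  unfold rM
  rw [sub_mul, one_mul, mul_sub, mul_one, pM_mul_pM D hℓ hMh hP, sub_self, sub_zero]

/-- `G′·Δ′_a = 1` on the torus. [cite: Balaban1984PropagatorsII, p.225 («G′ = Δ′_a^{−1}»)] -/
theorem G_mul_dP (hℓ : 1 ≤ ℓ) (hMh : 1 ≤ Mh) (hP : ∀ μ, 1 ≤ P μ) : GT D * dP D = 1 :=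
  B6Prop22MultiLevelTorus.gmlT_mul_mlOpT_pos (one_le_N0 hMh hP) D.one_le_lev D.lev_le (aPrinted_pos hℓ)

/-- `Δ′_a·G′ = 1` on the torus. [cite: Balaban1984PropagatorsII, p.225 («G′ = Δ′_a^{−1}»)] -/
theorem dP_mul_G (hℓ : 1 ≤ ℓ) (hMh : 1 ≤ Mh) (hP : ∀ μ, 1 ≤ P μ) : dP D * GT D = 1 :=
  mul_eq_one_comm.1 (G_mul_dP D hℓ hMh hP)

/-- the printed `λ = G′f − G′²Q′*(Q′G′²Q′*)⁻¹Q′G′f` of the line before (2.17). [cite: Balaban1984PropagatorsII, p.225 (line before (2.17))] -/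
def lamOf (f : ↥(boxDom (N0 ℓ Mh k P)) → ℝ) : ↥(boxDom (N0 ℓ Mh k P)) → ℝ :=
  GT D *ᵥ f - GT D *ᵥ (GT D *ᵥ (QsM D *ᵥ (GiM D *ᵥ (QM D *ᵥ (GT D *ᵥ f)))))

/-- `Q′λ = 0`: `λ ∈ N(Q′)`. [cite: Balaban1984PropagatorsII, p.225 («onto the subspace ΔN(Q′)»)] -/
theorem QM_mulVec_lamOf (hℓ : 1 ≤ ℓ) (hMh : 1 ≤ Mh) (hP : ∀ μ, 1 ≤ P μ) (f : ↥(boxDom (N0 ℓ Mh k P)) → ℝ) :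
    QM D *ᵥ lamOf D f = 0 := by
  unfold lamOf
  rw [Matrix.mulVec_sub]
  simp only [Matrix.mulVec_mulVec, ← Matrix.mul_assoc]
  rw [show QM D * GT D * GT D * QsM D * GiM D = 1 from (GiM_mul D hℓ hMh hP).2, Matrix.one_mul, sub_self]

/-- `Q′λ = 0` for the block-average map `QB` of the lineage. [cite: Balaban1984PropagatorsII, p.225 («onto the subspace ΔN(Q′)»)] -/
theorem QB_lamOf (hℓ : 1 ≤ ℓ) (hMh : 1 ≤ Mh) (hP : ∀ μ, 1 ≤ P μ) (f : ↥(boxDom (N0 ℓ Mh k P)) → ℝ) :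
    QB D.toDomains (lamOf D f) = 0 := by
  rw [QB_eq_QM_mulVec, QM_mulVec_lamOf D hℓ hMh hP]

/-- **(2.17) FOR THE GENUINE OPERATORS ON `T_η`**: `Rf = Δ′_aλ` with the printed `λ` (and `Q′λ = 0`, `QM_mulVec_lamOf`):
`R` maps into `Δ′_aN(Q′)`. [cite: Balaban1984PropagatorsII, (2.17) p.225 («Rf = Δλ = Δ′_aλ = f − G′Q′*(Q′G′²Q′*)⁻¹Q′G′f»)] -/
theorem rM_mulVec_eq (hℓ : 1 ≤ ℓ) (hMh : 1 ≤ Mh) (hP : ∀ μ, 1 ≤ P μ) (f : ↥(boxDom (N0 ℓ Mh k P)) → ℝ) :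
    rM D *ᵥ f = dP D *ᵥ lamOf D f := by
  unfold rM lamOf pM
  rw [Matrix.sub_mulVec, Matrix.one_mulVec, Matrix.mulVec_sub]
  simp only [Matrix.mulVec_mulVec, ← Matrix.mul_assoc]
  rw [dP_mul_G D hℓ hMh hP, Matrix.one_mulVec, Matrix.one_mul]

/-- `R` maps into `Δ′_aN(Q′)`, the range statement: `∀ f ∃ λ, Q′λ = 0 ∧ Rf = Δ′_aλ`. [cite: Balaban1984PropagatorsII, (2.17) p.225] -/
theorem rM_range_QB (hℓ : 1 ≤ ℓ) (hMh : 1 ≤ Mh) (hP : ∀ μ, 1 ≤ P μ) (f : ↥(boxDom (N0 ℓ Mh k P)) → ℝ) :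
    ∃ lam' : ↥(boxDom (N0 ℓ Mh k P)) → ℝ, QB D.toDomains lam' = 0 ∧ rM D *ᵥ f = dP D *ᵥ lam' :=
  ⟨lamOf D f, QB_lamOf D hℓ hMh hP f, rM_mulVec_eq D hℓ hMh hP f⟩

/-- … and `R` FIXES `Δ′_aN(Q′)`: `R(Δ′_aλ) = Δ′_aλ` whenever `Q′λ = 0` — with `R² = R`, `Rᵀ = R` (`rM_transpose`) this says
that `R = I − P` IS the orthogonal projection onto `Δ′_aN(Q′)` of p. 225, i.e. `pM` is the paper's `P`.
[cite: Balaban1984PropagatorsII, p.225 («let R be an orthogonal projection in the space L²(T_η) onto the subspace ΔN(Q′)»)] -/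
theorem rM_mulVec_dP_of_ker (hℓ : 1 ≤ ℓ) (hMh : 1 ≤ Mh) (hP : ∀ μ, 1 ≤ P μ) {lam' : ↥(boxDom (N0 ℓ Mh k P)) → ℝ}
    (h : QM D *ᵥ lam' = 0) : rM D *ᵥ (dP D *ᵥ lam') = dP D *ᵥ lam' := by
  unfold rM pM
  rw [Matrix.sub_mulVec, Matrix.one_mulVec, sub_eq_self]
  simp only [Matrix.mulVec_mulVec]
  rw [Matrix.mul_assoc _ (GT D) (dP D), G_mul_dP D hℓ hMh hP, Matrix.mul_one, ← Matrix.mulVec_mulVec, h,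
    Matrix.mulVec_zero]

/-- the same with the hypothesis `Q′λ = 0` through `QB`. [cite: Balaban1984PropagatorsII, p.225 («onto the subspace ΔN(Q′)»)] -/
theorem rM_mulVec_dP_of_QB (hℓ : 1 ≤ ℓ) (hMh : 1 ≤ Mh) (hP : ∀ μ, 1 ≤ P μ) {lam' : ↥(boxDom (N0 ℓ Mh k P)) → ℝ}
    (h : QB D.toDomains lam' = 0) : rM D *ᵥ (dP D *ᵥ lam') = dP D *ᵥ lam' :=
  rM_mulVec_dP_of_ker D hℓ hMh hP (by rw [← QB_eq_QM_mulVec]; exact h)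

/-- `Q′ = diag(W)⁻¹·Q′*ᵀ`. [cite: Balaban1984PropagatorsII, (2.69) p.235, bookkeeping] -/
theorem QM_eq_diag_mul : QM D = Matrix.diagonal (fun y => (W D.toDomains y)⁻¹) * (QsM D)ᵀ := by
  ext y x
  rw [Matrix.diagonal_mul, Matrix.transpose_apply]
  unfold QM QsM
  split_ifs <;> simp

/-- `Q′*ᵀ = diag(W)·Q′`. [cite: Balaban1984PropagatorsII, (2.69) p.235, bookkeeping] -/
theorem QsM_transpose : (QsM D)ᵀ = Matrix.diagonal (fun y => W D.toDomains y) * QM D := by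
  ext y x
  rw [Matrix.diagonal_mul, Matrix.transpose_apply]
  unfold QM QsM
  split_ifs
  · rw [mul_inv_cancel₀ (W_pos D.toDomains y).ne']
  · rw [mul_zero]

/-- `G′ᵀ = G′` on the torus. [cite: Balaban1984PropagatorsII, p.225 («a well defined, positive operator»)] -/
theorem GT_transpose : (GT D)ᵀ = GT D := gmlT_isSymm

/-- **`Pᵀ = P`**: the operator (2.17) is symmetric for the flat pairing of the torus (through `diag(W)·(Q′G′²Q′*)⁻¹`
symmetric, `Q′*ᵀG′²Q′*` symmetric, `G′ᵀ = G′`). [cite: Balaban1984PropagatorsII, (2.17) p.225 («orthogonal projection»)] -/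
theorem pM_transpose (hℓ : 1 ≤ ℓ) (hMh : 1 ≤ Mh) (hP : ∀ μ, 1 ≤ P μ) : (pM D)ᵀ = pM D := by
  have hG : (GT D)ᵀ = GT D := GT_transpose D
  obtain ⟨hGX, hXG⟩ := GiM_mul D hℓ hMh hP
  -- `Dg = diag(W)`, `Dgi = diag(W⁻¹)`
  obtain ⟨Dg, hDg⟩ : ∃ Dg : Matrix ↥(bset D.toDomains) ↥(bset D.toDomains) ℝ,
    Dg = Matrix.diagonal (fun y => W D.toDomains y) := ⟨_, rfl⟩
  obtain ⟨Dgi, hDgi⟩ : ∃ Dgi : Matrix ↥(bset D.toDomains) ↥(bset D.toDomains) ℝ,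
    Dgi = Matrix.diagonal (fun y => (W D.toDomains y)⁻¹) := ⟨_, rfl⟩
  have hDD : Dg * Dgi = 1 := by
    rw [hDg, hDgi, Matrix.diagonal_mul_diagonal, ← Matrix.diagonal_one]
    congr 1; funext y; exact mul_inv_cancel₀ (W_pos D.toDomains y).ne'
  have hDiD : Dgi * Dg = 1 := mul_eq_one_comm.1 hDD
  have hDgT : Dgᵀ = Dg := by rw [hDg, Matrix.diagonal_transpose]
  have L2 : (QsM D)ᵀ = Dg * QM D := by rw [hDg]; exact QsM_transpose D
  have L1 : (QM D)ᵀ = QsM D * Dgi := by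
    rw [QM_eq_diag_mul, Matrix.transpose_mul, Matrix.transpose_transpose, Matrix.diagonal_transpose, hDgi]
  -- `S = Q′*ᵀG′²Q′* = Dg·X` is symmetric (`X = Q′G′²Q′*`)
  have hS : Dg * (QM D * GT D * GT D * QsM D) = (QsM D)ᵀ * GT D * GT D * QsM D := by
    rw [L2]; simp only [Matrix.mul_assoc]
  have hSsymm : ((QsM D)ᵀ * GT D * GT D * QsM D)ᵀ = (QsM D)ᵀ * GT D * GT D * QsM D := by
    rw [Matrix.transpose_mul, Matrix.transpose_mul, Matrix.transpose_mul, Matrix.transpose_transpose, hG]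
    simp only [Matrix.mul_assoc]
  -- `T = Dg·GiM` is symmetric: `GiMᵀ·Dg·X = Dg = Dg·GiM·X`, cancel `X` by `X·GiM = 1`
  have hSG : (QsM D)ᵀ * GT D * GT D * QsM D * GiM D = Dg := by rw [← hS, Matrix.mul_assoc, hXG, Matrix.mul_one]
  have hTt : (GiM D)ᵀ * Dg * (QM D * GT D * GT D * QsM D) = Dg := by
    rw [Matrix.mul_assoc, hS, ← hSsymm, ← Matrix.transpose_mul, hSG, hDgT]
  have hT : (GiM D)ᵀ * Dg = Dg * GiM D := by
    have h1 : (GiM D)ᵀ * Dg * (QM D * GT D * GT D * QsM D) = Dg * GiM D * (QM D * GT D * GT D * QsM D) := by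
      rw [hTt, Matrix.mul_assoc, hGX, Matrix.mul_one]
    calc (GiM D)ᵀ * Dg = (GiM D)ᵀ * Dg * (QM D * GT D * GT D * QsM D) * GiM D := by
          rw [Matrix.mul_assoc ((GiM D)ᵀ * Dg), hXG, Matrix.mul_one]
      _ = Dg * GiM D * (QM D * GT D * GT D * QsM D) * GiM D := by rw [h1]
      _ = Dg * GiM D := by rw [Matrix.mul_assoc (Dg * GiM D), hXG, Matrix.mul_one]
  have hGi : Dgi * (GiM D)ᵀ * Dg = GiM D := by
    rw [Matrix.mul_assoc, hT, ← Matrix.mul_assoc, hDiD, Matrix.one_mul]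
  -- assemble
  calc (pM D)ᵀ = GT D * (QsM D * (Dgi * ((GiM D)ᵀ * (Dg * (QM D * GT D))))) := by
        unfold pM
        simp only [Matrix.transpose_mul, hG, L1, L2, Matrix.mul_assoc]
    _ = GT D * (QsM D * ((Dgi * (GiM D)ᵀ * Dg) * (QM D * GT D))) := by simp only [Matrix.mul_assoc]
    _ = pM D := by rw [hGi]; unfold pM; simp only [Matrix.mul_assoc]

/-- **`Rᵀ = R`**. [cite: Balaban1984PropagatorsII, (2.17) p.225 («orthogonal projection»)] -/
theorem rM_transpose (hℓ : 1 ≤ ℓ) (hMh : 1 ≤ Mh) (hP : ∀ μ, 1 ≤ P μ) : (rM D)ᵀ = rM D := by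
  unfold rM
  rw [Matrix.transpose_sub, Matrix.transpose_one, pM_transpose D hℓ hMh hP]

/-- the periodic forward difference of `G′λ`: `((∂_μG′)λ)(x) = (G′λ)(x + e_μ) − (G′λ)(x)`. [cite: Balaban1984PropagatorsII, (2.67) p.234 (the entry ∇G′λ), dictionary] -/
theorem dT_GT_mulVec (μ : Fin (d + 1)) (f : ↥(boxDom (N0 ℓ Mh k P)) → ℝ) (x : ↥(boxDom (N0 ℓ Mh k P))) :
    ((dT (N0 ℓ Mh k P) μ * GT D) *ᵥ f) x = (GT D *ᵥ f) (tshift (N0 ℓ Mh k P) (unitVec μ) x) - (GT D *ᵥ f) x := by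
  rw [← Matrix.mulVec_mulVec, dT_mulVec]

/-- the left factor `∂_μG′Q′*` has the entries `(∂_μG′λ_{y₁})(x)`. [cite: Balaban1984PropagatorsII, (2.88) p.238, bookkeeping] -/
theorem left_entry (μ : Fin (d + 1)) (x : ↥(boxDom (N0 ℓ Mh k P))) (y₁ : ↥(bset D.toDomains)) :
    (dT (N0 ℓ Mh k P) μ * GT D * QsM D) x y₁ = ((dT (N0 ℓ Mh k P) μ * GT D) *ᵥ lam D y₁) x := by
  rw [Matrix.mul_apply]
  rfl

/-- the right factor `Q′G′∂_νᵀ` has the entries `(L^{j₂})^{−(d+1)}·(∂_νG′λ_{y₂})(x′)` (`G′` symmetric).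
[cite: Balaban1984PropagatorsII, (2.88) p.238, bookkeeping] -/
theorem right_entry (ν : Fin (d + 1)) (y₂ : ↥(bset D.toDomains)) (x' : ↥(boxDom (N0 ℓ Mh k P))) :
    (QM D * GT D * (dT (N0 ℓ Mh k P) ν)ᵀ) y₂ x' =
      (W D.toDomains y₂)⁻¹ * ((dT (N0 ℓ Mh k P) ν * GT D) *ᵥ lam D y₂) x' := by
  have hsymm : ∀ a b : ↥(boxDom (N0 ℓ Mh k P)), GT D a b = GT D b a := fun a b => by
    have h' := congrFun (congrFun (GT_transpose D) b) a
    rw [Matrix.transpose_apply] at h'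
    exact h'
  rw [Matrix.mul_apply]
  simp only [Matrix.transpose_apply, Matrix.mul_apply]
  rw [← Matrix.mulVec_mulVec]
  simp only [Matrix.mulVec, dotProduct]
  rw [Finset.mul_sum]
  refine Finset.sum_congr rfl fun x'' _ => ?_
  have hQ : ∀ z, QM D y₂ z * GT D z x'' = (W D.toDomains y₂)⁻¹ * (GT D x'' z * lam D y₂ z) := by
    intro z
    unfold QM lam
    split_ifs with h
    · rw [hsymm z x'']; ring
    · ring
  simp_rw [hQ]
  rw [← Finset.mul_sum]
  ring

/-- the entries of a triple matrix product as a double sum. [folklore] -/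
private theorem triple_apply {X S : Type*} [Fintype X] [Fintype S] (A : Matrix X S ℝ) (B : Matrix S S ℝ)
    (Cm : Matrix S X ℝ) (x x' : X) : (A * B * Cm) x x' = ∑ y₁, ∑ y₂, A x y₁ * B y₁ y₂ * Cm y₂ x' := by
  rw [Matrix.mul_apply]
  simp_rw [Matrix.mul_apply, Finset.sum_mul]
  rw [Finset.sum_comm]

/-- **THE FACTORISATION OF (2.88), EXACT, ON `T_η`**: `(∂_μP∂*_ν)(x, x′) = Σ_{y₁,y₂∈𝔅} (∂_μG′Q′*)(x, y₁)·(Q′G′²Q′*)⁻¹(y₁, y₂)·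
(Q′G′∂*_ν)(y₂, x′)` with the middle factor in the (2.69) normalisation, `x ∈ B(y)`, `x′ ∈ B(y′)`.
[cite: Balaban1984PropagatorsII, (2.88) p.238 («|(∂_μG′Q′*(Q′G′²Q′*)⁻¹Q′G′∂*_ν)(x, x′)|»)] -/
theorem dPd_eq_comp3 (μ ν : Fin (d + 1)) (x x' : ↥(boxDom (N0 ℓ Mh k P))) :
    dPd D μ ν x x' = comp3 (K1 D μ x) (Cker D) (K3 D ν x') (blkOf D.toDomains x) (blkOf D.toDomains x') := by
  have hassoc : dPd D μ ν =
      (dT (N0 ℓ Mh k P) μ * GT D * QsM D) * GiM D * (QM D * GT D * (dT (N0 ℓ Mh k P) ν)ᵀ) := by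
    unfold dPd pM; simp only [Matrix.mul_assoc]
  rw [hassoc, triple_apply]
  unfold comp3
  refine Finset.sum_congr rfl fun y₁ _ => Finset.sum_congr rfl fun y₂ _ => ?_
  rw [left_entry, right_entry]
  unfold K1 K3 Cker GiM
  rw [if_pos rfl, if_pos rfl]
  ring

/-- **`∂P∂*` AS AN OPERATOR ON BOND FUNCTIONS OF THE TORUS** (carrier `T_η × {μ}`): `(∂P∂*f)(x, μ) =
Σ_{x′,ν}(∂_μP∂_νᵀ)(x, x′)f(x′, ν)`. [cite: Balaban1984PropagatorsII, (2.18) p.225, (2.88) p.238] -/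
def dPdOp : Module.End ℝ ((↥(boxDom (N0 ℓ Mh k P)) × Fin (d + 1)) → ℝ) :=
  Matrix.toLin' (Matrix.of fun p q : ↥(boxDom (N0 ℓ Mh k P)) × Fin (d + 1) => dPd D p.2 q.2 p.1 q.1)

/-- the action of `dPdOp`, unfolded. [cite: Balaban1984PropagatorsII, (2.88) p.238, bookkeeping] -/
theorem dPdOp_apply (f : (↥(boxDom (N0 ℓ Mh k P)) × Fin (d + 1)) → ℝ) (p : ↥(boxDom (N0 ℓ Mh k P)) × Fin (d + 1)) :
    dPdOp D f p = ∑ q : ↥(boxDom (N0 ℓ Mh k P)) × Fin (d + 1), dPd D p.2 q.2 p.1 q.1 * f q := by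
  unfold dPdOp
  rw [Matrix.toLin'_apply]
  rfl

end Kernel

/-! ## §2 The census geometry with the (2.60)-certified `R`; the census facts transferred; Lemma 2.1; print's units -/

section GeoBT

variable {ℓ : ℕ} (i : KTIdx d ℓ)

/-- the census geometry of the torus member in print's units with the (2.60)-certified `R` (`R·M = R·L·M_h − 1`, the walk
constant of `levelGapT`); all other fields are those of file T9's `geoTP`. [cite: Balaban1984PropagatorsII, (2.1)–(2.2) p.224, (2.60) p.234, dictionary] -/
def geoBT : Geometry :=
  { geoTP i with R := (i.R : ℝ) - 1 / (((ℓ : ℝ) + 1) * i.Mh) }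

/-- the (2.67) functionals of the member, re-packed on `geoBT`. [cite: Balaban1984PropagatorsII, Prop. 2.2 (2.67) p.234, dictionary] -/
def gpBT : GpFamily (geoBT i) := ⟨(gpTP i).e, (gpTP i).h1⟩

/-- the (2.69)-kernel of `(Q′G′²Q′*)⁻¹` of the member in print's units, re-packed on `geoBT`. [cite: Balaban1984PropagatorsII, (2.87) p.238, dictionary] -/
def CinvBT : SiteKernel (geoBT i) := ⟨(CinvTP i).ker⟩

/-- `R·M` of `geoBT` is the certified walk constant `R·L·M_h − 1`. [cite: Balaban1984PropagatorsII, (2.2) p.224, (2.60) p.234, dictionary] -/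
theorem geoBT_RM : (geoBT i).R * (geoBT i).M = (i.R : ℝ) * (((ℓ : ℝ) + 1) * i.Mh) - 1 := by
  have hM : (0 : ℝ) < ((ℓ : ℝ) + 1) * i.Mh := by
    have : (1 : ℝ) ≤ i.Mh := by exact_mod_cast i.hMh
    positivity
  show ((i.R : ℝ) - 1 / (((ℓ : ℝ) + 1) * i.Mh)) * (((ℓ : ℝ) + 1) * i.Mh) = _
  rw [sub_mul, one_div, inv_mul_cancel₀ hM.ne']

/-- `geoBT` in components: `M = L·M_h`. [cite: Balaban1984PropagatorsII, (2.2) p.224, dictionary] -/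
theorem geoBT_M : (geoBT i).M = ((ℓ : ℝ) + 1) * i.Mh := rfl
/-- … `L`. [cite: Balaban1984PropagatorsII, (2.1) p.224, dictionary] -/
theorem geoBT_L : (geoBT i).L = (ℓ : ℝ) + 1 := rfl
/-- … `η = L^{−k}`. [cite: Balaban1984PropagatorsII, (2.1) p.224, dictionary] -/
theorem geoBT_eta : (geoBT i).eta = (((nKT i : ℕ) : ℝ))⁻¹ := rfl
/-- … the lengths `L^jη`. [cite: Balaban1984PropagatorsII, (2.1) p.224, dictionary] -/
theorem geoBT_len (s : ↥(bset i.D.toDomains)) : (geoBT i).len s = ((ℓ : ℝ) + 1) ^ s.1.1 * (((nKT i : ℕ) : ℝ))⁻¹ := rfl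
/-- … the distance (2.46) of the torus. [cite: Balaban1984PropagatorsII, (2.46) p.231, dictionary] -/
theorem geoBT_dist (s t : ↥(bset i.D.toDomains)) : (geoBT i).dist s t = (geomT i.D).dist s t := rfl

/-- **PROPOSITION 2.2 ON `geoBT`** (file T9's `prop22Printed_kLevelTorusP`; the census statement does not involve `R`).
[cite: Balaban1984PropagatorsII, Prop. 2.2 (2.67) p.234] -/
theorem prop22Printed_kLevelBT (hℓ : 1 ≤ ℓ) : Prop22Printed (fun i : KTIdx d ℓ => geoBT i) (fun i => gpBT i) :=
  prop22Printed_kLevelTorusP d ℓ hℓ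

/-- **PROPOSITION 2.3 ON `geoBT`** (`prop23Printed_kLevelTorusP`). [cite: Balaban1984PropagatorsII, Prop. 2.3 (2.87) p.238] -/
theorem prop23Printed_kLevelBT (hℓ : 1 ≤ ℓ) :
    Prop23Printed (d + 1) (fun i : KTIdx d ℓ => geoBT i) (fun i => CinvBT i) :=
  prop23Printed_kLevelTorusP d ℓ hℓ

/-- (2.54) for `geoBT` (realised geometry). [cite: Balaban1984PropagatorsII, (2.54) p.233] -/
theorem triangle_geoBT : Triangle254 (geoBT i) := (triangle_refl_nonneg_T i.D i.hMh i.hP).1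

/-- `d_T ≥ 0` for `geoBT`. [cite: Balaban1984PropagatorsII, (2.46) p.231] -/
theorem dist_nonneg_geoBT (y y' : (geoBT i).Site) : 0 ≤ (geoBT i).dist y y' :=
  (triangle_refl_nonneg_T i.D i.hMh i.hP).2.2 y y'

/-- `d_T` is symmetric for `geoBT`. [cite: Balaban1984PropagatorsII, (2.46) p.231] -/
theorem dist_symm_geoBT (a b : (geoBT i).Site) : (geoBT i).dist a b = (geoBT i).dist b a := symmT i.D a b

/-- `R·L·M_h ≥ 1` for a member. [cite: Balaban1984PropagatorsII, (2.2) p.224, bookkeeping] -/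
theorem one_le_RM : 1 ≤ i.R * ((ℓ + 1) * i.Mh) :=
  Nat.one_le_iff_ne_zero.2 (Nat.mul_ne_zero_iff.2 ⟨by have := i.hR; omega,
    Nat.mul_ne_zero_iff.2 ⟨by omega, by have := i.hMh; omega⟩⟩)

/-- **(2.60) FOR `geoBT`** as the census display `Ineq260` (from `levelSepTB`: `(RM − 1)·max{|j−j′|−1,0} ≤ d_T`).
[cite: Balaban1984PropagatorsII, Lemma 2.1 (2.60) p.234] -/
theorem ineq260_geoBT {δ α : ℝ} (hαδ : 0 ≤ α * δ) : Ineq260 (geoBT i) δ α := by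
  intro y y'
  have hsep : LevelSep (geomTB i.D) := levelSepTB i.D i.hMh i.hP (one_le_RM i)
  have h : (geoBT i).R * (geoBT i).M * mx (geoBT i) y y' ≤ (geoBT i).dist y y' := hsep y y'
  apply Real.exp_le_exp.2
  have : α * δ * ((geoBT i).R * (geoBT i).M * mx (geoBT i) y y') ≤ α * δ * (geoBT i).dist y y' :=
    mul_le_mul_of_nonneg_left h hαδ
  unfold mx at this
  linarith

/-- the printed kernel in print's units: `(∂P∂*)_{μν}(x, x′) = η^{−2−(d+1)}·(∂_μP∂_νᵀ)(x, x′)` (`∂^η = η⁻¹∂`, `P` scale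
free, kernels of the `η`-lattice are `η^{−(d+1)}`× matrix entries). [cite: Balaban1984PropagatorsII, (2.88) p.238, (2.150) p.249, dictionary] -/
def dPdP (μ ν : Fin (d + 1)) (x x' : ↥(i.XB)) : ℝ := (((nKT i : ℕ) : ℝ)) ^ (2 + (d + 1)) * dPd i.D μ ν x x'

/-- the outer kernels in print's units: `η·K₁` (`∂^η G′_η = η·∂G′`). [cite: Balaban1984PropagatorsII, (2.88) p.238, dictionary] -/
def K1P (μ : Fin (d + 1)) (x : ↥(i.XB)) : ↥(bset i.D.toDomains) → ↥(bset i.D.toDomains) → ℝ :=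
  fun y y₁ => (((nKT i : ℕ) : ℝ))⁻¹ * K1 i.D μ x y y₁

/-- … and `η·K₃`. [cite: Balaban1984PropagatorsII, (2.88) p.238, dictionary] -/
def K3P (ν : Fin (d + 1)) (x' : ↥(i.XB)) : ↥(bset i.D.toDomains) → ↥(bset i.D.toDomains) → ℝ :=
  fun y₂ y' => (((nKT i : ℕ) : ℝ))⁻¹ * K3 i.D ν x' y₂ y'

/-- **THE FACTORISATION IN PRINT'S UNITS**: `(∂P∂*)_{μν}(x, x′) = Σ_{y₁,y₂} (ηK₁)(y, y₁)·Cinv(y₁, y₂)·(ηK₃)(y₂, y′)` with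
`Cinv` = file 4's `CinvTP`. [cite: Balaban1984PropagatorsII, (2.88) p.238] -/
theorem dPdP_eq_comp3 (μ ν : Fin (d + 1)) (x x' : ↥(i.XB)) :
    dPdP i μ ν x x' = comp3 (K1P i μ x) (CinvTP i).ker (K3P i ν x') (blkOf i.D.toDomains x) (blkOf i.D.toDomains x') := by
  have hη := nKT_pos i
  unfold dPdP
  rw [dPd_eq_comp3]
  unfold comp3 K1P K3P Cker
  simp_rw [CinvTP_ker]
  rw [Finset.mul_sum]
  refine Finset.sum_congr rfl fun y₁ _ => ?_
  rw [Finset.mul_sum]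
  refine Finset.sum_congr rfl fun y₂ _ => ?_
  have hn0 : (((nKT i : ℕ) : ℝ)) ≠ 0 := hη.ne'
  field_simp
  ring

end GeoBT

/-! ## §3 The reading discharged: `λ = Q′*δ_{y₁}` and the domination by entry (2.67)₂ (periodic differences) -/

section Reading

variable {ℓ : ℕ} (i : KTIdx d ℓ)

/-- `supp λ_{y₁} ⊂ B(y₁)` in the census sense. [cite: Balaban1984PropagatorsII, Prop. 2.2 p.234 («supp λ ⊂ B^{j′}(y′)»)] -/
theorem lam_suppIn (y₁ : ↥(bset i.D.toDomains)) : (geoBT i).suppIn (lam i.D y₁) y₁ := by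
  intro x hx
  by_contra h
  exact hx (by unfold lam; rw [if_neg h])

/-- `|λ_{y₁}| ≤ 1` (`c_Q = 1`). [cite: Balaban1984PropagatorsII, (2.3)–(2.4) p.224, bookkeeping] -/
theorem supNorm_lam_le (y₁ : ↥(bset i.D.toDomains)) : (geoBT i).supNorm (lam i.D y₁) ≤ 1 := by
  show i.supF (lam i.D y₁) ≤ 1
  unfold KTIdx.supF
  refine ciSup_le fun x => ?_
  unfold lam; split_ifs <;> simp

/-- entry (2.67)₂ of the member is non-negative. [cite: Balaban1984PropagatorsII, Prop. 2.2 (2.67) p.234, bookkeeping] -/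
theorem e1_nonneg (f : ↥(i.XB) → ℝ) (s : ↥(bset i.D.toDomains)) : 0 ≤ i.e1 f s := by
  unfold KTIdx.e1
  refine le_ciSup_of_le (Set.finite_range _).bddAbove ⟨i.origin, 0⟩ ?_
  split_ifs
  · exact abs_nonneg _
  · exact le_rfl

/-- the member's `G′` is the matrix `GT` of §1. [cite: Balaban1984PropagatorsII, p.225 («G′ = Δ′_a^{−1}»), dictionary] -/
theorem GT_member : GT i.D = i.G := rfl

/-- the lattice outer kernel is dominated by entry (2.67)₂: `|K₁(y, y₁)| ≤ e₁(λ_{y₁}, y)`. [cite: Balaban1984PropagatorsII, (2.88) p.238 («from … Proposition 2.2»)] -/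
theorem abs_K1_le (μ : Fin (d + 1)) (x : ↥(i.XB)) (y y₁ : ↥(bset i.D.toDomains)) :
    |K1 i.D μ x y y₁| ≤ i.e1 (lam i.D y₁) y := by
  unfold K1
  by_cases h : blkOf i.D.toDomains x = y
  · rw [if_pos h, dT_GT_mulVec, GT_member]
    unfold KTIdx.e1
    refine le_ciSup_of_le (Set.finite_range _).bddAbove ⟨x, μ⟩ ?_
    dsimp only
    rw [if_pos h]
  · rw [if_neg h, abs_zero]; exact e1_nonneg i _ _

/-- the same for `K₃`. [cite: Balaban1984PropagatorsII, (2.88) p.238] -/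
theorem abs_K3_le (ν : Fin (d + 1)) (x' : ↥(i.XB)) (y₂ y' : ↥(bset i.D.toDomains)) :
    |K3 i.D ν x' y₂ y'| ≤ i.e1 (lam i.D y₂) y' := by
  unfold K3
  by_cases h : blkOf i.D.toDomains x' = y'
  · rw [if_pos h, dT_GT_mulVec, GT_member]
    unfold KTIdx.e1
    refine le_ciSup_of_le (Set.finite_range _).bddAbove ⟨x', ν⟩ ?_
    dsimp only
    rw [if_pos h]
  · rw [if_neg h, abs_zero]; exact e1_nonneg i _ _

/-- **THE READING IN PRINT'S UNITS**: `|η·K₁(y, y₁)| ≤ (gpTP i).e 1 (λ_{y₁}) y` (entry `∇G′` of the genuine torus functionals,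
which carries the factor `η` of `∇^η`). [cite: Balaban1984PropagatorsII, (2.88) p.238, Prop. 2.2 (2.67) p.234] -/
theorem abs_K1P_le (μ : Fin (d + 1)) (x : ↥(i.XB)) (y y₁ : ↥(bset i.D.toDomains)) :
    |K1P i μ x y y₁| ≤ (gpBT i).e 1 (lam i.D y₁) y := by
  have hη := nKT_pos i
  show |(((nKT i : ℕ) : ℝ))⁻¹ * K1 i.D μ x y y₁| ≤
    ((((nKT i : ℕ) : ℝ))⁻¹) ^ (B6Prop22KLevelCensusEta.epow 1) * i.gp.e 1 (lam i.D y₁) y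
  have he : i.gp.e 1 = i.e1 := rfl
  rw [he, show B6Prop22KLevelCensusEta.epow 1 = 1 from rfl, pow_one, abs_mul, abs_of_pos (inv_pos.2 hη)]
  exact mul_le_mul_of_nonneg_left (abs_K1_le i μ x y y₁) (inv_nonneg.2 hη.le)

/-- … and for `K₃`. [cite: Balaban1984PropagatorsII, (2.88) p.238, Prop. 2.2 (2.67) p.234] -/
theorem abs_K3P_le (ν : Fin (d + 1)) (x' : ↥(i.XB)) (y₂ y' : ↥(bset i.D.toDomains)) :
    |K3P i ν x' y₂ y'| ≤ (gpBT i).e 1 (lam i.D y₂) y' := by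
  have hη := nKT_pos i
  show |(((nKT i : ℕ) : ℝ))⁻¹ * K3 i.D ν x' y₂ y'| ≤
    ((((nKT i : ℕ) : ℝ))⁻¹) ^ (B6Prop22KLevelCensusEta.epow 1) * i.gp.e 1 (lam i.D y₂) y'
  have he : i.gp.e 1 = i.e1 := rfl
  rw [he, show B6Prop22KLevelCensusEta.epow 1 = 1 from rfl, pow_one, abs_mul, abs_of_pos (inv_pos.2 hη)]
  exact mul_le_mul_of_nonneg_left (abs_K3_le i ν x' y₂ y') (inv_nonneg.2 hη.le)

end Reading

/-! ## §4 (2.88) for the genuine `k`-level kernel on the torus, print's units -/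

/-- `t^m ≤ e^{E}` once `m·log t ≤ E` (`t > 0`), for the largeness conditions `L⁴, L^{d+1}, L ≤ e^{αδRM}`. [cite: Balaban1984PropagatorsII, (2.59) p.233, bookkeeping] -/
private theorem rpow_le_exp_of_mul_log_le {t m E : ℝ} (ht : 0 < t) (h : m * Real.log t ≤ E) : t ^ m ≤ Real.exp E := by
  rw [Real.rpow_def_of_pos ht]
  exact Real.exp_le_exp.2 (by rw [mul_comm]; exact h)

/-- **[B6] (2.88), FIRST INEQUALITY, FOR THE GENUINE `k`-LEVEL KERNEL ON `T_η` — the census decl `B6Cor28.Ineq288`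
INHABITED**: `∃ M₃ δ₂ C > 0 ∀ i, M₃ ≤ L·M_h → ∀ μ ν x x′, Ineq288 (geoBT i) (d+1) (ηK₁) Cinv (ηK₃) C δ₂` for the genuine outer
kernels and the genuine `(Q′G′²Q′*)⁻¹` — `B6Ineq288Edge.ineq288_of_printed` BY NAME on `geoBT` fed with the transferred
census facts, the reading of §3, (2.54), (2.60)/(2.61) of the torus and the three largeness conditions (`α = ½`,
`δ = min(δ₀, δ₁)/4`). [cite: Balaban1984PropagatorsII, (2.88) p.238; Lemma 2.1 p.234; Prop. 2.2 p.234; Prop. 2.3 p.238] -/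
theorem ineq288_read_kLevelTorusP (d ℓ : ℕ) (hℓ : 1 ≤ ℓ) :
    ∃ M₃ δ₂ C : ℝ, 0 < M₃ ∧ 0 < δ₂ ∧ 0 < C ∧
      ∀ i : KTIdx d ℓ, M₃ ≤ ((ℓ : ℝ) + 1) * i.Mh → ∀ (μ ν : Fin (d + 1)) (x x' : ↥(i.XB)),
        Ineq288 (geoBT i) (d + 1) (K1P i μ x) (CinvTP i).ker (K3P i ν x') C δ₂ := by
  obtain ⟨M₂, δ₀, δ₁, C', C'', hM₂, hδ₀, hδ₁, hC', hC'', hall⟩ :=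
    ineq288_of_printed (d + 1) (fun i : KTIdx d ℓ => geoBT i) (fun i => gpBT i) (fun i => CinvBT i)
      (prop22Printed_kLevelBT (d := d) hℓ) (prop23Printed_kLevelBT (d := d) hℓ)
  have hL0 : (0 : ℝ) < (ℓ : ℝ) + 1 := by positivity
  have hL1 : (1 : ℝ) ≤ (ℓ : ℝ) + 1 := by linarith [(Nat.cast_nonneg ℓ : (0 : ℝ) ≤ ℓ)]
  have hlog : Real.log ((ℓ : ℝ) + 1) ≤ (ℓ : ℝ) + 1 := (Real.log_le_sub_one_of_pos hL0).trans (by linarith)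
  have hlog0 : 0 ≤ Real.log ((ℓ : ℝ) + 1) := Real.log_nonneg hL1
  -- the rate of Lemma 2.1: `δ = min(δ₀, δ₁)/4`, `α = ½`
  obtain ⟨δ, hδ⟩ : ∃ δ : ℝ, δ = min δ₀ δ₁ / 4 := ⟨_, rfl⟩
  have hδpos : 0 < δ := by rw [hδ]; exact div_pos (lt_min hδ₀ hδ₁) (by norm_num)
  have hδa : δ + 2 * (1 / 2 * δ) ≤ δ₀ / 2 := by
    have : min δ₀ δ₁ ≤ δ₀ := min_le_left _ _
    rw [hδ]; linarith
  have hδb : δ + 1 / 2 * δ ≤ δ₁ / 2 := by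
    have : min δ₀ δ₁ ≤ δ₁ := min_le_right _ _
    rw [hδ]; linarith
  -- the (2.59)-type threshold for (2.61) at `(δ, ½)` and the largeness thresholds
  obtain ⟨N₁, hN₁⟩ : ∃ N₁ : ℕ, N₁ = ⌈8 * ((d : ℝ) + 1) * ((ℓ : ℝ) + 1) / δ⌉₊ + 1 := ⟨_, rfl⟩
  have hN₁pos : 0 < N₁ := by rw [hN₁]; omega
  have hN₁ge : 8 * ((d : ℝ) + 1) * ((ℓ : ℝ) + 1) < δ * (N₁ : ℝ) := by
    have h : 8 * ((d : ℝ) + 1) * ((ℓ : ℝ) + 1) / δ < (N₁ : ℝ) := by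
      rw [hN₁]; push_cast; exact lt_of_le_of_lt (Nat.le_ceil _) (by linarith)
    rw [div_lt_iff₀ hδpos] at h; linarith
  have hθ1 : Real.exp (-(1 / 2 * δ)) * ((ℓ : ℝ) + 1) ^ ((2 * (d + 1 : ℕ) : ℝ) / N₁) < 1 := by
    refine theta_lt_one_of_log hL0 hN₁pos ?_
    push_cast
    have hd0 : (0 : ℝ) ≤ 2 * ((d : ℝ) + 1) := by positivity
    have h1 := mul_le_mul_of_nonneg_left hlog hd0
    have h2 : (0 : ℝ) ≤ ((d : ℝ) + 1) * ((ℓ : ℝ) + 1) := by positivity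
    linarith
  obtain ⟨N₂, hN₂⟩ : ∃ N₂ : ℕ, N₂ = ⌈2 * ((d : ℝ) + 5) * ((ℓ : ℝ) + 1) / δ⌉₊ := ⟨_, rfl⟩
  have hN₂ge : 2 * ((d : ℝ) + 5) * ((ℓ : ℝ) + 1) ≤ δ * (N₂ : ℝ) := by
    have h : 2 * ((d : ℝ) + 5) * ((ℓ : ℝ) + 1) / δ ≤ (N₂ : ℝ) := by rw [hN₂]; exact Nat.le_ceil _
    rw [div_le_iff₀ hδpos] at h; linarith
  obtain ⟨cL, hcL⟩ : ∃ cL : ℝ, cL = K261 N₁ (d + 1) ((ℓ : ℝ) + 1) 1 (1 / 2 * δ) := ⟨_, rfl⟩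
  have hcL0 : 0 ≤ cL := by rw [hcL]; exact K261_nonneg (by positivity) zero_le_one
  obtain ⟨M₃, hM₃⟩ : ∃ M₃ : ℝ, M₃ = max M₂ (max ((N₁ : ℝ) + 1) ((N₂ : ℝ) + 1)) := ⟨_, rfl⟩
  have hM₃pos : 0 < M₃ := by rw [hM₃]; exact lt_max_of_lt_left hM₂
  obtain ⟨C, hC⟩ : ∃ C : ℝ, C = C' * 1 * C'' * (C' * 1) * ((ℓ : ℝ) + 1) ^ (4 : ℝ) *
      ((ℓ : ℝ) + 1) ^ ((d + 1 : ℕ) : ℝ) * ((ℓ : ℝ) + 1) ^ (1 : ℝ) * cL ^ 3 + 1 := ⟨_, rfl⟩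
  have hCbase : 0 ≤ C' * 1 * C'' * (C' * 1) * ((ℓ : ℝ) + 1) ^ (4 : ℝ) *
      ((ℓ : ℝ) + 1) ^ ((d + 1 : ℕ) : ℝ) * ((ℓ : ℝ) + 1) ^ (1 : ℝ) * cL ^ 3 := by
    have := Real.rpow_nonneg hL0.le (4 : ℝ)
    have := Real.rpow_nonneg hL0.le ((d + 1 : ℕ) : ℝ)
    have := Real.rpow_nonneg hL0.le (1 : ℝ)
    have := hC'.le; have := hC''.le
    positivity
  have hCpos : 0 < C := by rw [hC]; linarith
  refine ⟨M₃, (1 - 1 / 2) * δ, C, hM₃pos, by positivity, hCpos, ?_⟩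
  intro i hM μ ν x x'
  -- the member's thresholds
  have hM2 : M₂ ≤ (geoBT i).M := by rw [geoBT_M]; exact (le_max_left _ _).trans (hM₃ ▸ hM)
  have hR1 : 1 ≤ i.R := le_trans (by omega) i.hR
  have hNle : ∀ N : ℕ, (N : ℝ) + 1 ≤ ((ℓ : ℝ) + 1) * i.Mh → N + 1 ≤ i.R * ((ℓ + 1) * i.Mh) := by
    intro N hN
    have h1 : ((N + 1 : ℕ) : ℝ) ≤ (((ℓ + 1) * i.Mh : ℕ) : ℝ) := by push_cast; exact hN
    have h2 : N + 1 ≤ (ℓ + 1) * i.Mh := by exact_mod_cast h1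
    exact h2.trans (Nat.le_mul_of_pos_left _ hR1)
  have hRM1 : N₁ + 1 ≤ i.R * ((ℓ + 1) * i.Mh) :=
    hNle N₁ (((le_max_left _ _).trans (le_max_right _ _)).trans (hM₃ ▸ hM))
  have hRM2 : N₂ + 1 ≤ i.R * ((ℓ + 1) * i.Mh) :=
    hNle N₂ (((le_max_right _ _).trans (le_max_right _ _)).trans (hM₃ ▸ hM))
  -- Lemma 2.1 on the torus at `(δ, ½)`
  obtain ⟨-, h261, -, -⟩ :=
    lemma21_torus i.D i.hMh i.hP hN₁pos hRM1 hδpos.le (α := 1 / 2) (by norm_num) (by norm_num) hθ1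
  have h261B : Ineq261With cL (geoBT i) δ (1 / 2) := by rw [hcL]; exact fun z => h261 z
  have h260B : Ineq260 (geoBT i) δ (1 / 2) := ineq260_geoBT i (by positivity)
  -- the three largeness conditions `L⁴, L^{d+1}, L ≤ e^{½δ·RM}`, `RM = R·L·M_h − 1 ≥ N₂`
  have hge : (N₂ : ℝ) ≤ (i.R : ℝ) * (((ℓ : ℝ) + 1) * i.Mh) - 1 := by
    have : ((N₂ + 1 : ℕ) : ℝ) ≤ ((i.R * ((ℓ + 1) * i.Mh) : ℕ) : ℝ) := by exact_mod_cast hRM2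
    push_cast at this; linarith
  have hE : ((d : ℝ) + 5) * Real.log ((ℓ : ℝ) + 1) ≤ 1 / 2 * δ * (geoBT i).R * (geoBT i).M := by
    rw [mul_assoc (1 / 2 * δ), geoBT_RM]
    have h3 := mul_le_mul_of_nonneg_left hge (by positivity : (0 : ℝ) ≤ 1 / 2 * δ)
    have hd5 : (0 : ℝ) ≤ (d : ℝ) + 5 := by positivity
    have h4 := mul_le_mul_of_nonneg_left hlog hd5
    linarith
  have hl4 : (geoBT i).L ^ (4 : ℝ) ≤ Real.exp (1 / 2 * δ * (geoBT i).R * (geoBT i).M) := by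
    rw [geoBT_L]; refine rpow_le_exp_of_mul_log_le hL0 (le_trans ?_ hE); nlinarith
  have hld : (geoBT i).L ^ ((d + 1 : ℕ) : ℝ) ≤ Real.exp (1 / 2 * δ * (geoBT i).R * (geoBT i).M) := by
    rw [geoBT_L]; refine rpow_le_exp_of_mul_log_le hL0 (le_trans ?_ hE); push_cast; nlinarith
  have hl1 : (geoBT i).L ^ (1 : ℝ) ≤ Real.exp (1 / 2 * δ * (geoBT i).R * (geoBT i).M) := by
    rw [geoBT_L]; refine rpow_le_exp_of_mul_log_le hL0 (le_trans ?_ hE); nlinarith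
  -- the edge, fired
  have h := hall i trivial hM2 (triangle_geoBT i) (dist_nonneg_geoBT i) (dist_symm_geoBT i) (by rw [geoBT_L]; exact hL1)
    (by rw [geoBT_eta]; exact inv_pos.2 (nKT_pos i)) 1 1 (fun t => rfl) (fun t => rfl) (K1P i μ x) (K3P i ν x')
    (lam i.D) (lam i.D) 1 zero_le_one (lam_suppIn i) (supNorm_lam_le i) (lam_suppIn i) (supNorm_lam_le i)
    (abs_K1P_le i μ x) (abs_K3P_le i ν x') δ (1 / 2) cL hδpos.le (by norm_num) (by norm_num) hδa hδb h260B h261B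
    hl4 hld hl1
  -- monotonicity in the constant
  intro y y'
  refine (h y y').trans ?_
  rw [geoBT_L]
  have hrest : 0 ≤ (geoBT i).len y ^ (-(2 : ℝ)) * (geoBT i).len y' ^ (-((d + 1 : ℕ) : ℝ)) *
      Real.exp (-((1 - 1 / 2) * δ * (geoBT i).dist y y')) := by
    have hl : ∀ s, 0 < (geoBT i).len s := fun s => by
      rw [geoBT_len]; exact mul_pos (pow_pos hL0 _) (inv_pos.2 (nKT_pos i))
    have := Real.rpow_nonneg (hl y).le (-(2 : ℝ))
    have := Real.rpow_nonneg (hl y').le (-((d + 1 : ℕ) : ℝ))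
    positivity
  have hCle : C' * 1 * C'' * (C' * 1) * ((ℓ : ℝ) + 1) ^ (4 : ℝ) * ((ℓ : ℝ) + 1) ^ ((d + 1 : ℕ) : ℝ) *
      ((ℓ : ℝ) + 1) ^ (1 : ℝ) * cL ^ 3 ≤ C := by rw [hC]; linarith
  calc C' * 1 * C'' * (C' * 1) * ((ℓ : ℝ) + 1) ^ (4 : ℝ) * ((ℓ : ℝ) + 1) ^ ((d + 1 : ℕ) : ℝ) *
        ((ℓ : ℝ) + 1) ^ (1 : ℝ) * cL ^ 3 * (geoBT i).len y ^ (-(2 : ℝ)) * (geoBT i).len y' ^ (-((d + 1 : ℕ) : ℝ)) *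
        Real.exp (-((1 - 1 / 2) * δ * (geoBT i).dist y y'))
      = C' * 1 * C'' * (C' * 1) * ((ℓ : ℝ) + 1) ^ (4 : ℝ) * ((ℓ : ℝ) + 1) ^ ((d + 1 : ℕ) : ℝ) *
        ((ℓ : ℝ) + 1) ^ (1 : ℝ) * cL ^ 3 * ((geoBT i).len y ^ (-(2 : ℝ)) * (geoBT i).len y' ^ (-((d + 1 : ℕ) : ℝ)) *
        Real.exp (-((1 - 1 / 2) * δ * (geoBT i).dist y y'))) := by ring
    _ ≤ C * ((geoBT i).len y ^ (-(2 : ℝ)) * (geoBT i).len y' ^ (-((d + 1 : ℕ) : ℝ)) *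
        Real.exp (-((1 - 1 / 2) * δ * (geoBT i).dist y y'))) := mul_le_mul_of_nonneg_right hCle hrest
    _ = _ := by ring

/-- **[B6] THE PRINTED (2.88) FOR THE GENUINE `k`-LEVEL KERNEL `(∂P∂*)_{μν}(x, x′)` ON `T_η`** in print's units:
`|(∂P∂*)_{μν}(x, x′)| ≤ C·(L^jη)^{−2}(L^{j′}η)^{−(d+1)}e^{−δ₂d_T(y,y′)}`, `x ∈ B^j(y)`, `x′ ∈ B^{j′}(y′)`, all `μ, ν`, for
every member with `L·M_h ≥ M₃` (every `k`, every nested family of the torus) — the census edge with every hypothesis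
discharged and the exact factorisation `dPdP_eq_comp3`. [cite: Balaban1984PropagatorsII, (2.88) p.238] -/
theorem ineq288_kLevelTorusP (d ℓ : ℕ) (hℓ : 1 ≤ ℓ) :
    ∃ M₃ δ₂ C : ℝ, 0 < M₃ ∧ 0 < δ₂ ∧ 0 < C ∧
      ∀ i : KTIdx d ℓ, M₃ ≤ ((ℓ : ℝ) + 1) * i.Mh → ∀ (μ ν : Fin (d + 1)) (x x' : ↥(i.XB)),
        |dPdP i μ ν x x'| ≤ C * (geoTP i).len (blkOf i.D.toDomains x) ^ (-(2 : ℝ)) *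
          (geoTP i).len (blkOf i.D.toDomains x') ^ (-((d + 1 : ℕ) : ℝ)) *
          Real.exp (-(δ₂ * (geomT i.D).dist (blkOf i.D.toDomains x) (blkOf i.D.toDomains x'))) := by
  obtain ⟨M₃, δ₂, C, hM₃, hδ₂, hC, h⟩ := ineq288_read_kLevelTorusP d ℓ hℓ
  refine ⟨M₃, δ₂, C, hM₃, hδ₂, hC, fun i hM μ ν x x' => ?_⟩
  have hI := h i hM μ ν x x' (blkOf i.D.toDomains x) (blkOf i.D.toDomains x')
  have hE := dPdP_eq_comp3 i μ ν x x'
  calc |dPdP i μ ν x x'|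
      = |comp3 (K1P i μ x) (CinvTP i).ker (K3P i ν x') (blkOf i.D.toDomains x) (blkOf i.D.toDomains x')| := by rw [hE]
    _ ≤ _ := hI

/-- **NON-VACUITY**: above every threshold there are members with `k ≥ 2` genuine levels (file T8's `kLevelTorus_nonvacuous`).
[cite: Balaban1984PropagatorsII, (2.1)–(2.4) p.224, bookkeeping] -/
theorem ineq288_kLevelTorusP_nonvacuous (d ℓ k : ℕ) (hk : 2 ≤ k) (M₃ : ℝ) :
    ∃ i : KTIdx d ℓ, i.k = k ∧ M₃ ≤ ((ℓ : ℝ) + 1) * i.Mh :=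
  let ⟨i, h1, h2, _, _, _⟩ := kLevelTorusP_nonvacuous d ℓ k hk M₃
  ⟨i, h1, h2⟩

/-! ## §5 (2.88) in lattice units, for the family `D` itself -/

/-- print-unit powers: `(L^j·η)^{−m} = η^{−m}·(L^j)^{−m}`, `η⁻¹ = L^k`. [cite: Balaban1984PropagatorsII, (2.88) p.238, dictionary] -/
private theorem rpow_len_eta {t n : ℝ} (ht : 0 < t) (hn : 0 < n) (m : ℕ) :
    (t * n⁻¹) ^ (-(m : ℝ)) = n ^ m * (t ^ m)⁻¹ := by
  rw [Real.mul_rpow ht.le (inv_nonneg.2 hn.le), Real.inv_rpow hn.le, Real.rpow_neg hn.le, inv_inv,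
    Real.rpow_natCast, Real.rpow_neg ht.le, Real.rpow_natCast, mul_comm]

/-- **(2.88) IN LATTICE UNITS FOR A MEMBER**: `|(∂_μP∂_νᵀ)(x, x′)| ≤ C/((L^j)²·W(y′))·e^{−δ₂d_T(y,y′)}`, `W(y′) = (L^{j′})^{d+1}`
(print's `(L^jη)^{−2}(L^{j′}η)^{−(d+1)}` with the `η`-powers of `dPdP = η^{−(d+3)}dPd` cancelled).
[cite: Balaban1984PropagatorsII, (2.88) p.238, dictionary] -/
theorem ineq288_kLevelTorus_lattice (d ℓ : ℕ) (hℓ : 1 ≤ ℓ) :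
    ∃ M₃ δ₂ C : ℝ, 0 < M₃ ∧ 0 < δ₂ ∧ 0 < C ∧
      ∀ i : KTIdx d ℓ, M₃ ≤ ((ℓ : ℝ) + 1) * i.Mh → ∀ (μ ν : Fin (d + 1)) (x x' : ↥(i.XB)),
        |dPd i.D μ ν x x'| ≤ C / ((geomT i.D).len (blkOf i.D.toDomains x) ^ 2 * W i.D.toDomains (blkOf i.D.toDomains x')) *
          Real.exp (-(δ₂ * (geomT i.D).dist (blkOf i.D.toDomains x) (blkOf i.D.toDomains x'))) := by
  obtain ⟨M₃, δ₂, C, hM₃, hδ₂, hC, h⟩ := ineq288_kLevelTorusP d ℓ hℓ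
  refine ⟨M₃, δ₂, C, hM₃, hδ₂, hC, fun i hM μ ν x x' => ?_⟩
  have hb := h i hM μ ν x x'
  have hη := nKT_pos i
  have hL0 : (0 : ℝ) < (ℓ : ℝ) + 1 := by positivity
  obtain ⟨y, hy⟩ : ∃ y, y = blkOf i.D.toDomains x := ⟨_, rfl⟩
  obtain ⟨y', hy'⟩ : ∃ y', y' = blkOf i.D.toDomains x' := ⟨_, rfl⟩
  rw [← hy, ← hy'] at hb ⊢
  have hLj : (0 : ℝ) < ((ℓ : ℝ) + 1) ^ y.1.1 := pow_pos hL0 _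
  have hLj' : (0 : ℝ) < ((ℓ : ℝ) + 1) ^ y'.1.1 := pow_pos hL0 _
  have e2 := rpow_len_eta hLj hη 2
  have ed := rpow_len_eta hLj' hη (d + 1)
  push_cast at e2
  rw [geoTP_len, geoTP_len, e2, ed] at hb
  unfold dPdP at hb
  rw [abs_mul, abs_of_pos (pow_pos hη _)] at hb
  rw [W_eq_lenT_pow, lenT_eq, lenT_eq]
  -- cancel `η^{−(d+3)} = n^2·n^{d+1}`
  have hn : (((nKT i : ℕ) : ℝ)) ^ (2 + (d + 1)) = (((nKT i : ℕ) : ℝ)) ^ 2 * (((nKT i : ℕ) : ℝ)) ^ (d + 1) := pow_add _ _ _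
  rw [hn] at hb
  have hpos : 0 < (((nKT i : ℕ) : ℝ)) ^ 2 * (((nKT i : ℕ) : ℝ)) ^ (d + 1) := by positivity
  have key : (((nKT i : ℕ) : ℝ)) ^ 2 * (((nKT i : ℕ) : ℝ)) ^ (d + 1) * |dPd i.D μ ν x x'| ≤
      (((nKT i : ℕ) : ℝ)) ^ 2 * (((nKT i : ℕ) : ℝ)) ^ (d + 1) *
        (C / ((((ℓ : ℝ) + 1) ^ y.1.1) ^ 2 * (((ℓ : ℝ) + 1) ^ y'.1.1) ^ (d + 1)) *
          Real.exp (-(δ₂ * (geomT i.D).dist y y'))) := by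
    refine hb.trans (le_of_eq ?_)
    field_simp
  exact le_of_mul_le_mul_left key hpos

/-- `1 ≤ k` for a nested family of the torus: every site has a level in `1 … k`.
[cite: Balaban1984PropagatorsII, (2.1) p.224, bookkeeping] -/
theorem one_le_k_of_TDomains {ℓ Mh k R : ℕ} {P : Fin (d + 1) → ℕ} (D : TDomains d ℓ Mh k P R) : 1 ≤ k :=
  (D.one_le_lev 0).trans (D.lev_le 0)

/-- **[B6] (2.88) IN LATTICE UNITS FOR EVERY NESTED FAMILY OF THE TORUS** (the consumer shape of p22's
`B6ScalarChartV1.hasMajorant_Dg_chart`): `∃ M₃ δ₂ C > 0` (on `d, L`) `∀ k, M_h` with `L·M_h ≥ M₃`, `R ≥ 2L`, `P_μ ≥ 4`,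
`∀ D μ ν x x′`, `|(∂_μ·P·∂_νᵀ)(x, x′)| ≤ C/((L^{j(x)})²·(L^{j(x′)})^{d+1})·e^{−δ₂d_T(y(x),y(x′))}` with `P = pM D` the genuine
(2.17) and `∂_μ = dT` periodic. [cite: Balaban1984PropagatorsII, (2.88) p.238, (2.17)–(2.18) p.225] -/
theorem ineq288_multiLevelTorus (d ℓ : ℕ) (hℓ : 1 ≤ ℓ) :
    ∃ M₃ δ₂ C : ℝ, 0 < M₃ ∧ 0 < δ₂ ∧ 0 < C ∧
      ∀ (k Mh R : ℕ), M₃ ≤ ((ℓ : ℝ) + 1) * Mh → 2 * (ℓ + 1) ≤ R →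
      ∀ (P : Fin (d + 1) → ℕ) (_hP4 : ∀ μ, 4 ≤ P μ) (D : TDomains d ℓ Mh k P R) (μ ν : Fin (d + 1))
        (x x' : ↥(boxDom (N0 ℓ Mh k P))),
        |dPd D μ ν x x'| ≤ C / ((geomT D).len (blkOf D.toDomains x) ^ 2 * W D.toDomains (blkOf D.toDomains x')) *
          Real.exp (-(δ₂ * (geomT D).dist (blkOf D.toDomains x) (blkOf D.toDomains x'))) := by
  obtain ⟨M₃, δ₂, C, hM₃, hδ₂, hC, h⟩ := ineq288_kLevelTorus_lattice d ℓ hℓ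
  refine ⟨M₃, δ₂, C, hM₃, hδ₂, hC, fun k Mh R hM hR P hP4 D μ ν x x' => ?_⟩
  have hMh : 1 ≤ Mh := by
    by_contra h0
    have : Mh = 0 := by omega
    rw [this, Nat.cast_zero, mul_zero] at hM
    linarith
  exact h ⟨k, Mh, R, P, D, one_le_k_of_TDomains D, hMh, hR, hP4⟩ hM μ ν x x'

/-- `I − R = P`. [cite: Balaban1984PropagatorsII, (2.17)–(2.18) p.225] -/
theorem one_sub_rM {ℓ Mh k R : ℕ} {P : Fin (d + 1) → ℕ} (D : TDomains d ℓ Mh k P R) : 1 - rM D = pM D := by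
  unfold rM; rw [sub_sub_cancel]

/-- **(2.88) IN LATTICE UNITS, THE CHART SHAPE** (the letters of p22's `B6ScalarChartV1.hasMajorant_Dg_chart` with
`Rm := rM D`): `|((S_μ − 1)·(1 − R)·(S_ν − 1)ᵀ)(x, x′)| ≤ C/(L^{j(x)})²/W(y(x′))·e^{−δ₂d_T}`, `S_μ` the shift by `e_μ`.
[cite: Balaban1984PropagatorsII, (2.88) p.238, (2.17)–(2.18) p.225] -/
theorem ineq288_multiLevelTorus_chartShape (d ℓ : ℕ) (hℓ : 1 ≤ ℓ) :
    ∃ M₃ δ₂ C : ℝ, 0 < M₃ ∧ 0 < δ₂ ∧ 0 < C ∧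
      ∀ (k Mh R : ℕ), M₃ ≤ ((ℓ : ℝ) + 1) * Mh → 2 * (ℓ + 1) ≤ R →
      ∀ (P : Fin (d + 1) → ℕ) (_hP4 : ∀ μ, 4 ≤ P μ) (D : TDomains d ℓ Mh k P R) (μ ν : Fin (d + 1))
        (x x' : ↥(boxDom (N0 ℓ Mh k P))),
        |((shiftMat (N0 ℓ Mh k P) (unitVec μ) - 1) * (1 - rM D) * (shiftMat (N0 ℓ Mh k P) (unitVec ν) - 1)ᵀ :
            Matrix ↥(boxDom (N0 ℓ Mh k P)) ↥(boxDom (N0 ℓ Mh k P)) ℝ) x x'| ≤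
          C / (geomT D).len (blkOf D.toDomains x) ^ 2 / W D.toDomains (blkOf D.toDomains x') *
            Real.exp (-(δ₂ * (geomT D).dist (blkOf D.toDomains x) (blkOf D.toDomains x'))) := by
  obtain ⟨M₃, δ₂, C, hM₃, hδ₂, hC, h⟩ := ineq288_multiLevelTorus d ℓ hℓ
  refine ⟨M₃, δ₂, C, hM₃, hδ₂, hC, fun k Mh R hM hR P hP4 D μ ν x x' => ?_⟩
  rw [one_sub_rM, div_div]
  exact h k Mh R hM hR P hP4 D μ ν x x'

/-! ## §6 The (2.88)-shape block majorant of `∂P∂*` on the bond carrier of the torus -/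

/-- **THE (2.88)-SHAPE MAJORANT OF `∂P∂*` ON BOND FUNCTIONS OF `T_η`** (the hypothesis `hDg` of p38's
`B6Ineq2134KFamKLevelTorus.h2134_kFam_torus`, on r05's geometry `geomTB D`): `∃ M₃ δ₂ > 0, C_P ≥ 0` (on `d, L`) such that for
`L·M_h ≥ M₃`, `R ≥ 2L`, `P_μ ≥ 4` and every `D`, for every bond function `f` supported over the block `y″` with `|f| ≤ B`:
`|(∂P∂*f)(x, μ)| ≤ C_P/(L^{j(x)})²·e^{−δ₂d_T(y(x),y″)}·B` — (2.88) summed over `x′ ∈ B(y″)` and `ν`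
(`#B(y″)·(L^{j″})^{−(d+1)} ≤ 1`, `C_P = (d+1)·C`). [cite: Balaban1984PropagatorsII, (2.88) p.238, (2.51) p.232 (majorant shape)] -/
theorem hasMajorant_dPd_multiLevelTorus (d ℓ : ℕ) (hℓ : 1 ≤ ℓ) :
    ∃ M₃ δ₂ CP : ℝ, 0 < M₃ ∧ 0 < δ₂ ∧ 0 ≤ CP ∧
      ∀ (k Mh R : ℕ), M₃ ≤ ((ℓ : ℝ) + 1) * Mh → 2 * (ℓ + 1) ≤ R →
      ∀ (P : Fin (d + 1) → ℕ) (_hP4 : ∀ μ, 4 ≤ P μ) (D : TDomains d ℓ Mh k P R),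
        HasMajorant (g := geomTB D) (fun p : ↥(boxDom (N0 ℓ Mh k P)) × Fin (d + 1) => blkOf D.toDomains p.1) (dPdOp D)
          (fun y y'' => CP / (geomTB D).len y ^ 2 * Real.exp (-(δ₂ * (geomTB D).dist y y''))) := by
  classical
  obtain ⟨M₃, δ₂, C, hM₃, hδ₂, hC, h⟩ := ineq288_multiLevelTorus d ℓ hℓ
  refine ⟨M₃, δ₂, ((d : ℝ) + 1) * C, hM₃, hδ₂, by positivity, fun k Mh R hM hR P hP4 D => ?_⟩
  intro y'' f B hf p
  change ↥(bset D.toDomains) at y''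
  obtain ⟨x, μ⟩ := p
  have hB := hf.nonneg
  rw [dPdOp_apply]
  show |∑ q : ↥(boxDom (N0 ℓ Mh k P)) × Fin (d + 1), dPd D μ q.2 x q.1 * f q| ≤
    ((d : ℝ) + 1) * C / (geomTB D).len (blkOf D.toDomains x) ^ 2 *
      Real.exp (-(δ₂ * (geomTB D).dist (blkOf D.toDomains x) y'')) * B
  rw [geomTB_len, mul_one, geomTB_dist]
  -- the bound on one entry, zero outside the block of `y″`
  have hW := W_pos D.toDomains y''
  have hlen : 0 < (((ℓ : ℝ) + 1) ^ (blkOf D.toDomains x).1.1) := by positivity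
  obtain ⟨E, hE⟩ : ∃ E : ℝ, E = C / ((((ℓ : ℝ) + 1) ^ (blkOf D.toDomains x).1.1) ^ 2 * W D.toDomains y'') *
      Real.exp (-(δ₂ * (geomT D).dist (blkOf D.toDomains x) y'')) := ⟨_, rfl⟩
  have hE0 : 0 ≤ E := by rw [hE]; positivity
  have hterm : ∀ q : ↥(boxDom (N0 ℓ Mh k P)) × Fin (d + 1),
      |dPd D μ q.2 x q.1 * f q| ≤ if blkOf D.toDomains q.1 = y'' then E * B else 0 := by
    rintro ⟨x', ν⟩
    dsimp only
    split_ifs with hq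
    · rw [abs_mul]
      have h1 := h k Mh R hM hR P hP4 D μ ν x x'
      rw [hq, lenT_eq] at h1
      rw [← hE] at h1
      exact mul_le_mul h1 (hf.bound ⟨x', ν⟩ hq) (abs_nonneg _) hE0
    · rw [hf.off ⟨x', ν⟩ hq, mul_zero, abs_zero]
  calc |∑ q : ↥(boxDom (N0 ℓ Mh k P)) × Fin (d + 1), dPd D μ q.2 x q.1 * f q|
      ≤ ∑ q : ↥(boxDom (N0 ℓ Mh k P)) × Fin (d + 1), |dPd D μ q.2 x q.1 * f q| := Finset.abs_sum_le_sum_abs _ _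
    _ ≤ ∑ q : ↥(boxDom (N0 ℓ Mh k P)) × Fin (d + 1), (if blkOf D.toDomains q.1 = y'' then E * B else 0) :=
        Finset.sum_le_sum fun q _ => hterm q
    _ = ∑ x' : ↥(boxDom (N0 ℓ Mh k P)), ∑ _ν : Fin (d + 1), (if blkOf D.toDomains x' = y'' then E * B else 0) :=
        Fintype.sum_prod_type _
    _ = ∑ x' : ↥(boxDom (N0 ℓ Mh k P)), (if blkOf D.toDomains x' = y'' then ((d : ℝ) + 1) * (E * B) else 0) := by
        refine Finset.sum_congr rfl fun x' _ => ?_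
        split_ifs
        · rw [Finset.sum_const, Finset.card_univ, Fintype.card_fin, nsmul_eq_mul]; push_cast; ring
        · rw [Finset.sum_const_zero]
    _ = (((Finset.univ.filter fun x' : ↥(boxDom (N0 ℓ Mh k P)) => blkOf D.toDomains x' = y'').card : ℕ) : ℝ) *
          (((d : ℝ) + 1) * (E * B)) := by
        rw [← Finset.sum_filter, Finset.sum_const, nsmul_eq_mul]
    _ ≤ W D.toDomains y'' * (((d : ℝ) + 1) * (E * B)) :=
        mul_le_mul_of_nonneg_right (card_blkOf_le D.toDomains y'') (by positivity)
    _ = ((d : ℝ) + 1) * C / (((ℓ : ℝ) + 1) ^ (blkOf D.toDomains x).1.1) ^ 2 *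
          Real.exp (-(δ₂ * (geomT D).dist (blkOf D.toDomains x) y'')) * B := by
        rw [hE]; field_simp

end

end Literature.MathematicalPhysics.QuantumFieldTheory.Balaban1983to89.B6Ineq288MultiLevelTorus
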